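import Mathlib
import Literature.MathematicalPhysics.QuantumFieldTheory.Balaban1983to89.Beta.Composition
import Literature.MathematicalPhysics.QuantumFieldTheory.Balaban1983to89.Beta.CompositionOneLoop

/-!
# `Balaban1983to89.Beta.GaugeFixing` — β sub-cell, Stage 0 (journal node BETA-0/FP-KERNEL): LINEARISED FADDEEV–POPOV
IDENTITIES for bordered (KKT) determinants — at one loop the exponential gauge fixing of [Balaban1987RG1] (0.14) and the
δ-function (block axial) gauge fixing of [Balaban1985BackgroundPropagators] (3.155) give the same polarization, MODULO A
TYPED DICTIONARY; kernel-checked finite-dimensional algebra, no facts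

HONEST FRAMING (cell rule, verbatim): discharging `BetaPertH` makes Bałaban's UV stability UNCONDITIONAL — a real
constructive-QFT result; it is NOT the continuum limit and NOT the Clay problem.  THIS MODULE DISCHARGES NOTHING of the
series: it proves identities of matrix algebra over a field (logarithmic forms over `ℝ`, Hessian forms over the cell's
`Beta.OneLoop` objects) which settle, AT THE LEVEL OF THE CELL'S ONE-LOOP MODEL, the question raised between the cell's two
numerical engines (row num ENGINE-A: δ/axial gauge; ENGINE-B: exponential gauge): the one-loop coefficient read off a
δ-constrained Gaussian normalisation does not depend on which of the two linearised gauge fixings is used, PROVIDED the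
dictionary clauses (c1)–(c3) below hold for the concrete operators — and those clauses are HYPOTHESES here, to be verified by
the rows that build the operators (OBJECTS.md §5), never asserted.  Value = kernel identity + a typed dictionary, NOT summit
progress (audit cell `pub-balaban`, unit `b2b-balaban-pv25`, node BETA-0/FP-KERNEL; companions GAPS C-pv25-*, G-beta-8,
DIVERGENCE D-pv25.4, `HOME/BETA/OBJECTS.md` §5(h)).

CITATION HEADER (lean-in-tree rule 2026-08-18).  Sources, read by the cell on the x2 page renders; this file quotes only what
fixes WHICH two gauge fixings are compared and asserts nothing about the series' operators:
* T. Bałaban, *Renormalization group approach to lattice gauge field theories. I. Generation of effective actions in a small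
  field approximation and a coupling constant renormalization in four dimensions*, Commun. Math. Phys. **109**, 249–301
  (1987) [Balaban1987RG1] (cell paper B12).  p. 254: «Even with these restrictions the underintegral expression in (0.13) is
  still invariant with respect to the gauge transformations u satisfying u(y) = 1 for y ∈ T^{(1)}. We have to fix a gauge in
  order to remove this invariance, as in [9, 16], where the block axial gauge was used to this purpose. … It is inconvenient
  to fix the gauge by the δ-functions δ(U(y,x)), because unlike the axial gauge fixing in [9, 16] these functions determine
  complicated nonlinear restrictions on gauge fields. Instead we introduce exponential gauge fixing functions,
  exp[−(1/2α)|U(y,x) − 1|²] = exp[−(1/α)[1 − Re tr U(y,x)]]. (0.14)»;  p. 254, on the two block averages: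
  «Let us stress that both definitions are equally good for our purposes, in fact we may use many other definitions.»;
  p. 255 (after
  (0.15)): «We introduce (0.15) under the integral in (0.13) and we apply the usual Faddeev-Popov procedure, i.e. we change
  the order of integrations and apply the gauge transformation U→U^{u⁻¹} with u(y) = 1 for y ∈ T^{(1)}. By the
  gauge invariance with respect to such transformations the integrand does not depend on u and the integral over u is
  equal to 1. Thus we get (0.16)»;  p. 266 (2.5): «the gauge fixing expression has the representation
  G(B′) = Σ_{y∈T^{(k+1)}} Σ_{x∈B(y),x≠y} ½|B̃′(y,x)|² + G₃(B′) = ½G^{(2)}(B′) + G₃(B′)»,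
  B̃′(y,x) «a linear function»;  p. 267 (after (2.11)): «The quadratic form in B′ above is equal to −1/2⟨B′,Δ^{(k)}B′⟩,
  see the definition (3.156) [13] with the δ-function gauge fixing term replaced by the exponential one. This quadratic
  form defines the k-th normalization factor Z^{(k)}(U_{k+1}) given by the formula (1.4) with j = k.»
* T. Bałaban, *Propagators for lattice gauge theories in a background field*, Commun. Math. Phys. **99**, 389–434 (1985)
  [Balaban1985BackgroundPropagators] (B9 = ref. [13] of B12).  p. 427 (3.155):
  «e^{½⟨g,C^{(k)}(Λ)g⟩} = (Z^{(k)}(Λ))⁻¹ ∫dB↾_Λ δ(Q₁B)δ_{Ax}(B) · exp[−½⟨H₁B,G₁⁻¹H₁B⟩ + ½a⟨B,B⟩ + ⟨H₁D̃^{(2)}(B),J⟩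
  + ⟨B,g⟩]»;  p. 428 (3.156): «⟨B,(QG₁Q*)⁻¹B⟩ − a⟨B,B⟩ − 2⟨H₁D̃^{(2)}(B),J⟩ = ⟨B,Δ_kB⟩. This form is considered on
  the subspace {B: B = 0 on Λᶜ, B = 0 on ∪_{y∈Λ′} Ax(y), Q₁B = 0}.»
So in print the one-loop normalisation is a δ-CONSTRAINED GAUSSIAN whose residual linearised gauge freedom is removed EITHER
by the constraint «B = 0 on ∪ Ax(y)» (δ/axial: a SLICE) OR by the quadratic weight `½G^{(2)}(B) = Σ ½|B̃′(y,x)|²`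
(exponential: a WEIGHT on slice rows); p. 255's Faddeev–Popov sentence is the GROUP-LEVEL statement that the choice is
immaterial.  This module proves the LINEARISED (one-loop, finite-dimensional) counterpart and nothing more.

THE MODEL (finite-dimensional; notation of the sibling module `Beta.Composition`, imported, not restated:
`kkt H C = [[H, Cᵀ],[C, 0]]`, `logZ H C = ((|ν|−|μ|)/2)·log 2π − ½·log|det kkt H C|`).  A square form `H` (Bałaban: the
fluctuation form `K` bordered by the averaging constraints `Q̃`, `H = kkt K Q`), GAUGE DIRECTIONS `W : α → ρ` (columns = a
basis of the linearised residual gauge orbit directions) with `H W = 0` (gauge invariance of the form AND gauge-compatibility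
of the constraints: `K W = 0`, `Q W = 0`, lemma `kkt_mul_fromRows`), a SLICE `τ : ρ × α` with `τ W` invertible (the slice is
transversal to the orbit: δ-gauge = constraint `τ v = 0`; exponential gauge = weight `exp(−½ vᵀτᵀAτ v)`).

WHAT IS PROVED (all `[folklore]`; §1 over any field, §2 with Bałaban's constraints kept as a block, §3 logarithmic over `ℝ`,
§4 over the cell's `Beta.OneLoop` objects `ConstrainedGaussian` / `Family` / `polarization` / `torusBetaZero`):
* (L0) ξ-INDEPENDENCE `det_fromBlocks_eq_det_kkt`: `H W = 0`, `τ W` invertible ⇒ `det [[H, τᵀ],[τ, X]] = det kkt H τ` for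
  EVERY square `X` (the "gauge parameter" block is invisible).
* (L1) WEIGHT ≡ CONSTRAINT `det_add_weight`: `+ A` invertible ⇒ `det (H + τᵀ A τ) = (−1)^{|ρ|} · det A · det kkt H τ`;
  with the constraints kept `det_kkt_add_weight`: `det kkt (K + τᵀAτ) Q = (−1)^{|ρ|} · det A · det kkt K [Q; τ]`;
  logarithmic, UNIT weight, NO side condition: `logZ_add_weight_one`: `logZ (K + τᵀτ) Q = logZ K [Q; τ] + (|ρ|/2)·log 2π`.
* (L2) SLICE CHANGE `det_kkt_slice_change` (two-sided directions `H W = 0`, `Hᵀ W = 0`; `τ W`, `P W` invertible):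
  `det kkt H P · det(τW)² = det kkt H τ · det(PW)²` — the squares of the LINEARISED FADDEEV–POPOV DETERMINANTS; it rests on
  the shear invariance `det_kkt_add_null` (`N W = 0 ⇒ det kkt H (P + N) = det kkt H P`, via `det(1 − AB) = det(1 − BA)`) and
  the scaling `det_kkt_mul_slice`; logarithmic `logZ_slice_change` (nondegenerate case):
  `logZ K [Q; τ] = logZ K [Q; P] − log|det(τW)| + log|det(PW)|`.  The one-sided hypothesis `H W = 0` alone does NOT suffice
  for (L2) (2 × 2 counterexample in the cell notes); for symmetric `H` the two coincide.
* §4: `withWeight Z τ := (Q, Δ + τᵀτ)`, `withSlice Z τ := ([Q; τ], Δ)` on the cell's `Fin`-indexed datum; `logZ_withWeight`,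
  `logZ_withSlice_change`; `polarization_eq_of_logZ_eventuallyEq_add_const` (two families whose `log Z` differ near `B = 0`
  by a constant have the same polarization — the Hessian kills constants, no differentiability needed); and the headline
  `polarization_withWeight_eq_withSlice` (I: weight on `τ` ≡ δ on `τ`, under (c1) (c2) only),
  `polarization_withSlice_eq_withSlice` (II: δ on `τ` ≡ δ on `P`, under (c1)–(c3)), `polarization_withWeight_eq_withSlice'`
  (I + II) and `torusBetaZero_withWeight_eq_withSlice` (same `β⁰_T`).

THE DICTIONARY (hypotheses of the §4 theorems; what a concrete row must verify, OBJECTS.md §5(h); NOT asserted here):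
(c1) `Δ(B)·W(B) = 0` (and `Δ(B)ᵀ·W(B) = 0`, automatic for symmetric `Δ(B)`): the background-field fluctuation form is
annihilated by the linearised residual gauge directions at background `B`;  (c2) `Q(B)·W(B) = 0`: the (background-covariant)
averaging constraints are gauge-compatible;  admissibility: `τ(B)·W(B)` and `P(B)·W(B)` invertible, and `det kkt ≠ 0` for II;
(c3) the Faddeev–Popov quotient `log|det(P(B)W(B))| − log|det(τ(B)W(B))|` is CONSTANT in `B` near `0`.  If (c3) fails the
two polarizations differ by the Hessian at `0` of that quotient (read off `logZ_withSlice_change`) — a typed, computable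
discrepancy, not an ambiguity.  Which concrete `τ` models (2.5) («B̃′(y,x)», `x ≠ y` in the block of `y`) and which `P`
models «B = 0 on ∪ Ax(y)» is for the row building the family to state; (0.15)–(0.16) at group level stay a reading.

ABSOLUTE RULE observed: no statement of the audited papers is used as a hypothesis-free fact; the quotations above only fix
terminology; every `theorem` below is kernel-checked algebra/analysis over Mathlib and the sibling modules `Beta.Composition`,
`Beta.CompositionOneLoop`, `Beta.OneLoop` (used by name, not restated).  No `def … : Prop`, no `sorry`, no `axiom`.

## v1.1 (2026-08-19; audit cell `pub-balaban`, unit `b2b-balaban-pv25` gen 17, journal row BETA-0/FP-KERNEL-DEFECT°) — APPEND-ONLY §5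
Every v1 declaration above/below is byte-identical; §5 «THE SLICE-CHANGE DEFECT» is ADDED at the end of the file.  It
TYPES the failure case of clause (c3) that the v1 dictionary only read off in words: differentiating `logZ_withSlice_change`
twice at `B = 0` gives `polarization (withSlice F τ) = polarization (withSlice F P) − hessianAt log|det(τW)| +
hessianAt log|det(PW)|` entrywise (`polarization_withSlice_eq_sub_add`, II′), under (c1) (c2), admissibility,
nondegeneracy AND — new, because the Hessian of a sum only splits for `C²` germs — `ContDiffAt ℝ 2 · 0` of one `log Z` and
of the two Faddeev–Popov logarithms; the half-constant / unipotent case (`|det(P(B)W(B))| = 1` near `0` ⇒ `Π_P = Π_τ +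
Hess₀ log|det(τW)|`, `polarization_withSlice_eq_add_of_abs_det_eq_one`, II″), the weight analogue (I + II′) and the
BASIS-FREENESS of the quotient (`fpQuotient_basis_change`: `W ↦ W·G` shifts both logarithms by `log|det G|`, so (c3) and
the defect see only the two slices and the span of the directions).  TRIGGER, not a source: the β-sub-cell lead finding
F-lead-g12-1 (cell journal, 2026-08-19) asked this lineage to check (c3) and §2's identity; WHICH concrete slice of which row
is unipotent or not along which directions, and what the defect then equals, is that row's to state — nothing of the series
is used or discharged here (value = kernel identity, NOT summit progress).
-/

namespace Literature.MathematicalPhysics.QuantumFieldTheory.Balaban1983to89.Beta.GaugeFixing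

open Literature.MathematicalPhysics.QuantumFieldTheory.Balaban1983to89.Beta.Composition
open Matrix

/-! ## §1. The three identities over a field, for a general square form `H` with gauge directions `W` (`H W = 0`) -/

section Field

variable {𝕜 : Type*} [Field 𝕜]
variable {α ρ : Type*} [Fintype α] [Fintype ρ] [DecidableEq α] [DecidableEq ρ]

/-- (L0) ξ-INDEPENDENCE.  `H W = 0`, `τ W` invertible ⇒ `det [[H, τᵀ],[τ, X]] = det [[H, τᵀ],[τ, 0]]` for every square `X`:
right-multiply by the unimodular `[[1, W (τW)⁻¹ X],[0, 1]]`. [folklore] -/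
theorem det_fromBlocks_eq_det_kkt (H : Matrix α α 𝕜) (τ : Matrix ρ α 𝕜) (W : Matrix α ρ 𝕜)
    (hHW : H * W = 0) (hT : IsUnit (τ * W).det) (X : Matrix ρ ρ 𝕜) :
    (fromBlocks H τᵀ τ X).det = (kkt H τ).det := by
  have hU : kkt H τ * fromBlocks (1 : Matrix α α 𝕜) (W * (τ * W)⁻¹ * X) 0 (1 : Matrix ρ ρ 𝕜) =
      fromBlocks H τᵀ τ X := by
    have e1 : H * (W * (τ * W)⁻¹ * X) = 0 := by
      rw [← Matrix.mul_assoc, ← Matrix.mul_assoc, hHW, Matrix.zero_mul, Matrix.zero_mul]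
    have e2 : τ * (W * (τ * W)⁻¹ * X) = X := by
      rw [← Matrix.mul_assoc, ← Matrix.mul_assoc, Matrix.mul_nonsing_inv _ hT, Matrix.one_mul]
    unfold kkt
    rw [fromBlocks_multiply]
    simp only [Matrix.mul_one, Matrix.mul_zero, add_zero, zero_add, e1, e2]
  have hdetU : (fromBlocks (1 : Matrix α α 𝕜) (W * (τ * W)⁻¹ * X) 0 (1 : Matrix ρ ρ 𝕜)).det = 1 := by
    rw [det_fromBlocks_zero₂₁, det_one, det_one, mul_one]
  rw [← hU, det_mul, hdetU, mul_one]

/-- (L1) WEIGHT ≡ CONSTRAINT.  `H W = 0`, `τ W` and `A` invertible ⇒ `det (H + τᵀ A τ) = (−1)^{|ρ|} · det A · det kkt H τ`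
(Schur complement of `[[H, τᵀ],[τ, −A⁻¹]]` combined with (L0) at `X = −A⁻¹`). [folklore] -/
theorem det_add_weight (H : Matrix α α 𝕜) (τ : Matrix ρ α 𝕜) (W : Matrix α ρ 𝕜) (A : Matrix ρ ρ 𝕜)
    (hHW : H * W = 0) (hT : IsUnit (τ * W).det) (hA : IsUnit A.det) :
    (H + τᵀ * A * τ).det = (-1) ^ Fintype.card ρ * A.det * (kkt H τ).det := by
  have h1 : fromBlocks (1 : Matrix α α 𝕜) 0 0 (-A) * fromBlocks H τᵀ τ (-A⁻¹) = fromBlocks H τᵀ (-A * τ) 1 := by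
    rw [fromBlocks_multiply]
    simp [Matrix.mul_nonsing_inv _ hA]
  have h2 : (fromBlocks H τᵀ (-A * τ) (1 : Matrix ρ ρ 𝕜)).det = (H + τᵀ * A * τ).det := by
    rw [det_fromBlocks_one₂₂, Matrix.neg_mul, Matrix.mul_neg, sub_neg_eq_add, Matrix.mul_assoc]
  have h3 : (fromBlocks (1 : Matrix α α 𝕜) 0 0 (-A)).det = (-1) ^ Fintype.card ρ * A.det := by
    rw [det_fromBlocks_zero₂₁, det_one, one_mul, det_neg]
  rw [← h2, ← h1, det_mul, h3, det_fromBlocks_eq_det_kkt H τ W hHW hT]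

/-- Scaling the slice rows by a square matrix `C` conjugates the bordered matrix. [folklore] -/
theorem kkt_mul_slice (H : Matrix α α 𝕜) (τ : Matrix ρ α 𝕜) (C : Matrix ρ ρ 𝕜) :
    kkt H (C * τ) = fromBlocks (1 : Matrix α α 𝕜) 0 0 C * kkt H τ * fromBlocks (1 : Matrix α α 𝕜) 0 0 Cᵀ := by
  unfold kkt
  rw [fromBlocks_multiply, fromBlocks_multiply]
  simp [Matrix.transpose_mul]

/-- … hence `det kkt H (C τ) = (det C)² · det kkt H τ`. [folklore] -/
theorem det_kkt_mul_slice (H : Matrix α α 𝕜) (τ : Matrix ρ α 𝕜) (C : Matrix ρ ρ 𝕜) :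
    (kkt H (C * τ)).det = C.det ^ 2 * (kkt H τ).det := by
  rw [kkt_mul_slice, det_mul, det_mul, det_fromBlocks_zero₂₁, det_fromBlocks_zero₂₁, det_one, one_mul, one_mul,
    det_transpose]
  ring

/-- Shear invariance: adding to the slice rows any `N` vanishing on the gauge directions does not change the bordered
determinant (two-sided null directions). [folklore] -/
theorem det_kkt_add_null (H : Matrix α α 𝕜) (P N : Matrix ρ α 𝕜) (W : Matrix α ρ 𝕜)
    (hHW : H * W = 0) (hHtW : Hᵀ * W = 0) (hNW : N * W = 0) (hS : IsUnit (P * W).det) :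
    (kkt H (P + N)).det = (kkt H P).det := by
  set E : Matrix α α 𝕜 := 1 - W * (P * W)⁻¹ * N with hE
  have hWtH : Wᵀ * H = 0 := by
    have := congrArg Matrix.transpose hHtW
    simpa [Matrix.transpose_mul] using this
  have hHE : H * E = H := by
    rw [hE, Matrix.mul_sub, Matrix.mul_one, ← Matrix.mul_assoc, ← Matrix.mul_assoc, hHW]; simp
  have hPNE : (P + N) * E = P := by
    rw [hE, Matrix.mul_sub, Matrix.mul_one, ← Matrix.mul_assoc, ← Matrix.mul_assoc, Matrix.add_mul, hNW, add_zero,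
      Matrix.mul_nonsing_inv _ hS, Matrix.one_mul, add_sub_cancel_right]
  have hEtH : Eᵀ * H = H := by
    rw [hE, Matrix.transpose_sub, Matrix.transpose_one, Matrix.sub_mul, Matrix.one_mul, Matrix.transpose_mul,
      Matrix.transpose_mul, Matrix.mul_assoc, Matrix.mul_assoc, hWtH]; simp
  have hEtPN : Eᵀ * (P + N)ᵀ = Pᵀ := by
    rw [← Matrix.transpose_mul, hPNE]
  have hdetE : E.det = 1 := by
    rw [hE, Matrix.mul_assoc, det_one_sub_mul_comm, Matrix.mul_assoc, hNW, Matrix.mul_zero, sub_zero, det_one]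
  have hLMU : fromBlocks Eᵀ 0 0 (1 : Matrix ρ ρ 𝕜) * kkt H (P + N) * fromBlocks E 0 0 (1 : Matrix ρ ρ 𝕜) = kkt H P := by
    unfold kkt
    rw [fromBlocks_multiply, fromBlocks_multiply]
    simp only [Matrix.zero_mul, Matrix.mul_zero, add_zero, zero_add, Matrix.one_mul, Matrix.mul_one]
    rw [Matrix.mul_assoc, hHE, hEtH, hEtPN, hPNE]
  have := congrArg Matrix.det hLMU
  rw [det_mul, det_mul, det_fromBlocks_zero₂₁, det_fromBlocks_zero₂₁, det_transpose, det_one, hdetE] at this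
  simpa using this

/-- (L2) SLICE CHANGE (linearised Faddeev–Popov).  Two-sided directions `H W = 0`, `Hᵀ W = 0`, slices `τ`, `P` with `τ W`,
`P W` invertible ⇒ `det kkt H P · det(τ W)² = det kkt H τ · det(P W)²`.  (Decompose `P = (PW)(τW)⁻¹ τ + N` with `N W = 0`;
shear invariance, then scaling.) [folklore] -/
theorem det_kkt_slice_change (H : Matrix α α 𝕜) (τ P : Matrix ρ α 𝕜) (W : Matrix α ρ 𝕜)
    (hHW : H * W = 0) (hHtW : Hᵀ * W = 0) (hT : IsUnit (τ * W).det) (hS : IsUnit (P * W).det) :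
    (kkt H P).det * (τ * W).det ^ 2 = (kkt H τ).det * (P * W).det ^ 2 := by
  -- decompose `P = (S T⁻¹) τ + N` with `N W = 0`
  set N : Matrix ρ α 𝕜 := P - (P * W) * (τ * W)⁻¹ * τ with hN
  have hNW : N * W = 0 := by
    rw [hN, Matrix.sub_mul, Matrix.mul_assoc, Matrix.mul_assoc, Matrix.nonsing_inv_mul _ hT, Matrix.mul_one, sub_self]
  have hP : P = (P * W) * (τ * W)⁻¹ * τ + N := by rw [hN]; abel
  have hS' : IsUnit ((P * W) * (τ * W)⁻¹ * τ * W).det := by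
    rw [Matrix.mul_assoc, Matrix.mul_assoc, Matrix.nonsing_inv_mul _ hT, Matrix.mul_one]; exact hS
  have h1 : (kkt H P).det = (kkt H ((P * W) * (τ * W)⁻¹ * τ)).det := by
    conv_lhs => rw [hP]
    exact det_kkt_add_null H _ N W hHW hHtW hNW hS'
  rw [h1, det_kkt_mul_slice, det_mul, det_nonsing_inv]
  have hTu : (τ * W).det * Ring.inverse (τ * W).det = 1 := Ring.mul_inverse_cancel _ hT
  have : ((P * W).det * Ring.inverse (τ * W).det) ^ 2 * (kkt H τ).det * (τ * W).det ^ 2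
      = (P * W).det ^ 2 * (kkt H τ).det * ((τ * W).det * Ring.inverse (τ * W).det) ^ 2 := by ring
  rw [this, hTu]; ring

/-- (L1) + (L2): `det (H + τᵀ A τ) · det(P W)² = (−1)^{|ρ|} · det A · det(τ W)² · det kkt H P`. [folklore] -/
theorem det_add_weight_slice_change (H : Matrix α α 𝕜) (τ P : Matrix ρ α 𝕜) (W : Matrix α ρ 𝕜) (A : Matrix ρ ρ 𝕜)
    (hHW : H * W = 0) (hHtW : Hᵀ * W = 0) (hT : IsUnit (τ * W).det) (hS : IsUnit (P * W).det) (hA : IsUnit A.det) :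
    (H + τᵀ * A * τ).det * (P * W).det ^ 2 = (-1) ^ Fintype.card ρ * A.det * (τ * W).det ^ 2 * (kkt H P).det := by
  rw [det_add_weight H τ W A hHW hT hA, mul_assoc ((-1) ^ Fintype.card ρ * A.det), mul_assoc ((-1) ^ Fintype.card ρ * A.det),
    ← det_kkt_slice_change H τ P W hHW hHtW hT hS]
  ring

end Field

/-! ## §2. Keeping Bałaban's `δ(Q̃·)` constraints: the three-block form -/

section ThreeBlock

variable {𝕜 : Type*} [Field 𝕜]
variable {ν μ ρ : Type*} [Fintype ν] [Fintype μ] [Fintype ρ] [DecidableEq ν] [DecidableEq μ] [DecidableEq ρ]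

omit [Fintype ρ] [DecidableEq ν] [DecidableEq μ] [DecidableEq ρ] in
/-- The bordered matrix of `K` constrained by `Q` annihilates the padded gauge directions `[W; 0]` iff `K W = 0` and
`Q W = 0`: `kkt K Q * fromRows W 0 = fromRows (K W) (Q W)`. [folklore] -/
theorem kkt_mul_fromRows (K : Matrix ν ν 𝕜) (Q : Matrix μ ν 𝕜) (W : Matrix ν ρ 𝕜) :
    kkt K Q * fromRows W (0 : Matrix μ ρ 𝕜) = fromRows (K * W) (Q * W) := by
  unfold kkt
  rw [fromBlocks_mul_fromRows]
  simp

omit [Fintype ρ] [DecidableEq ν] [DecidableEq μ] [DecidableEq ρ] in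
/-- Transposed version: `(kkt K Q)ᵀ * [W; 0] = [Kᵀ W; Q W]`. [folklore] -/
theorem kkt_transpose_mul_fromRows (K : Matrix ν ν 𝕜) (Q : Matrix μ ν 𝕜) (W : Matrix ν ρ 𝕜) :
    (kkt K Q)ᵀ * fromRows W (0 : Matrix μ ρ 𝕜) = fromRows (Kᵀ * W) (Q * W) := by
  unfold kkt
  rw [fromBlocks_transpose, fromBlocks_mul_fromRows]
  simp

omit [Fintype ρ] [DecidableEq ν] [DecidableEq μ] [DecidableEq ρ] in
/-- The padded slice `[τ | 0]` sees only the variable block: `[τ | 0] * [W; 0] = τ W`. [folklore] -/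
theorem fromCols_zero_mul_fromRows_zero (τ : Matrix ρ ν 𝕜) (W : Matrix ν ρ 𝕜) :
    fromCols τ (0 : Matrix ρ μ 𝕜) * fromRows W (0 : Matrix μ ρ 𝕜) = τ * W := by
  rw [fromCols_mul_fromRows]; simp

omit [Fintype ν] [Fintype μ] [DecidableEq ν] [DecidableEq μ] [DecidableEq ρ] in
/-- Adding the weight `τᵀ A τ` to the form = adding `[τ|0]ᵀ A [τ|0]` to the bordered matrix:
`kkt (K + τᵀ A τ) Q = kkt K Q + [τ|0]ᵀ A [τ|0]`. [folklore] -/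
theorem kkt_add_weight (K : Matrix ν ν 𝕜) (Q : Matrix μ ν 𝕜) (τ : Matrix ρ ν 𝕜) (A : Matrix ρ ρ 𝕜) :
    kkt (K + τᵀ * A * τ) Q = kkt K Q + (fromCols τ (0 : Matrix ρ μ 𝕜))ᵀ * A * fromCols τ (0 : Matrix ρ μ 𝕜) := by
  unfold kkt
  rw [transpose_fromCols, fromRows_mul, fromRows_mul_fromCols, fromBlocks_add]
  simp

omit [Fintype ν] [Fintype μ] [Fintype ρ] [DecidableEq ν] [DecidableEq μ] [DecidableEq ρ] in
/-- Reassociation: bordering the bordered matrix `kkt K Q` by the padded slice `[τ|0]` is, up to the canonical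
reindexing `(ν ⊕ μ) ⊕ ρ ≃ ν ⊕ (μ ⊕ ρ)`, the bordered matrix of `K` with the STACKED constraints `[Q; τ]`. [folklore] -/
theorem reindex_kkt_kkt (K : Matrix ν ν 𝕜) (Q : Matrix μ ν 𝕜) (τ : Matrix ρ ν 𝕜) :
    reindex (Equiv.sumAssoc ν μ ρ) (Equiv.sumAssoc ν μ ρ) (kkt (kkt K Q) (fromCols τ (0 : Matrix ρ μ 𝕜))) =
      kkt K (fromRows Q τ) := by
  ext (i | j | k) (i' | j' | k') <;> simp [kkt, Matrix.reindex_apply, Matrix.submatrix_apply]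

/-- Hence equal determinants: `det kkt (kkt K Q) [τ|0] = det kkt K [Q; τ]`. [folklore] -/
theorem det_kkt_kkt (K : Matrix ν ν 𝕜) (Q : Matrix μ ν 𝕜) (τ : Matrix ρ ν 𝕜) :
    (kkt (kkt K Q) (fromCols τ (0 : Matrix ρ μ 𝕜))).det = (kkt K (fromRows Q τ)).det := by
  rw [← reindex_kkt_kkt K Q τ, det_reindex_self]

/-- (L1) with the constraints kept.  `K W = 0`, `Q W = 0`, `τ W` and `A` invertible ⇒
`det kkt (K + τᵀ A τ) Q = (−1)^{|ρ|} · det A · det kkt K [Q; τ]`: the exponential gauge-fixing weight on the slice `τ`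
is the `δ`-function gauge fixing on the same slice, up to `det A`. [folklore] -/
theorem det_kkt_add_weight (K : Matrix ν ν 𝕜) (Q : Matrix μ ν 𝕜) (τ : Matrix ρ ν 𝕜) (W : Matrix ν ρ 𝕜)
    (A : Matrix ρ ρ 𝕜) (hKW : K * W = 0) (hQW : Q * W = 0) (hT : IsUnit (τ * W).det) (hA : IsUnit A.det) :
    (kkt (K + τᵀ * A * τ) Q).det = (-1) ^ Fintype.card ρ * A.det * (kkt K (fromRows Q τ)).det := by
  have hHW : kkt K Q * fromRows W (0 : Matrix μ ρ 𝕜) = 0 := by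
    rw [kkt_mul_fromRows, hKW, hQW, fromRows_zero]
  have hT' : IsUnit (fromCols τ (0 : Matrix ρ μ 𝕜) * fromRows W (0 : Matrix μ ρ 𝕜)).det := by
    rw [fromCols_zero_mul_fromRows_zero]; exact hT
  rw [kkt_add_weight, det_add_weight _ _ _ A hHW hT' hA, det_kkt_kkt]

/-- (L2) with the constraints kept.  `K W = 0`, `Kᵀ W = 0`, `Q W = 0`, `τ W` and `P W` invertible ⇒
`det kkt K [Q; P] · det(τ W)² = det kkt K [Q; τ] · det(P W)²`. [folklore] -/
theorem det_kkt_fromRows_slice_change (K : Matrix ν ν 𝕜) (Q : Matrix μ ν 𝕜) (τ P : Matrix ρ ν 𝕜)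
    (W : Matrix ν ρ 𝕜) (hKW : K * W = 0) (hKtW : Kᵀ * W = 0) (hQW : Q * W = 0) (hT : IsUnit (τ * W).det)
    (hS : IsUnit (P * W).det) :
    (kkt K (fromRows Q P)).det * (τ * W).det ^ 2 = (kkt K (fromRows Q τ)).det * (P * W).det ^ 2 := by
  have hHW : kkt K Q * fromRows W (0 : Matrix μ ρ 𝕜) = 0 := by
    rw [kkt_mul_fromRows, hKW, hQW, fromRows_zero]
  have hHtW : (kkt K Q)ᵀ * fromRows W (0 : Matrix μ ρ 𝕜) = 0 := by
    rw [kkt_transpose_mul_fromRows, hKtW, hQW, fromRows_zero]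
  have h := det_kkt_slice_change (kkt K Q) (fromCols τ (0 : Matrix ρ μ 𝕜)) (fromCols P (0 : Matrix ρ μ 𝕜))
    (fromRows W (0 : Matrix μ ρ 𝕜)) hHW hHtW (by rw [fromCols_zero_mul_fromRows_zero]; exact hT)
    (by rw [fromCols_zero_mul_fromRows_zero]; exact hS)
  rwa [fromCols_zero_mul_fromRows_zero, fromCols_zero_mul_fromRows_zero, det_kkt_kkt, det_kkt_kkt] at h

end ThreeBlock

/-! ## §3. Logarithmic forms over `ℝ` (the closed-form `log Z` of the sibling module `Composition`) -/

section RealLog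

variable {ν μ ρ : Type*} [Fintype ν] [Fintype μ] [Fintype ρ] [DecidableEq ν] [DecidableEq μ] [DecidableEq ρ]

/-- EXPONENTIAL GAUGE FIXING WITH UNIT WEIGHT = δ-FUNCTION GAUGE FIXING ON THE SAME SLICE, exactly and unconditionally
in the degenerate case too: `K W = 0`, `Q W = 0`, `τ W` invertible ⇒
`logZ (K + τᵀ τ) Q = logZ K [Q; τ] + (|ρ|/2) · log 2π` — the two closed forms differ by the `B`-free Gaussian constant
of the `|ρ|` gauge degrees of freedom; NO Faddeev–Popov determinant appears. [folklore] -/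
theorem logZ_add_weight_one (K : Matrix ν ν ℝ) (Q : Matrix μ ν ℝ) (τ : Matrix ρ ν ℝ) (W : Matrix ν ρ ℝ)
    (hKW : K * W = 0) (hQW : Q * W = 0) (hT : IsUnit (τ * W).det) :
    logZ (K + τᵀ * τ) Q = logZ K (fromRows Q τ) + (Fintype.card ρ : ℝ) / 2 * Real.log (2 * Real.pi) := by
  have h := det_kkt_add_weight K Q τ W (1 : Matrix ρ ρ ℝ) hKW hQW hT (by rw [det_one]; exact isUnit_one)
  rw [Matrix.mul_one, det_one, mul_one] at h
  unfold logZ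
  rw [h, abs_mul, abs_pow, abs_neg, abs_one, one_pow, one_mul, Fintype.card_sum, Nat.cast_add]
  ring

/-- General invertible weight `A`, nondegenerate case: `logZ (K + τᵀ A τ) Q = logZ K [Q; τ] + (|ρ|/2)·log 2π − ½·log|det A|`.
(For `det kkt K [Q;τ] = 0` both `logZ` are junk values and the identity is not claimed.) [folklore] -/
theorem logZ_add_weight (K : Matrix ν ν ℝ) (Q : Matrix μ ν ℝ) (τ : Matrix ρ ν ℝ) (W : Matrix ν ρ ℝ)
    (A : Matrix ρ ρ ℝ) (hKW : K * W = 0) (hQW : Q * W = 0) (hT : IsUnit (τ * W).det) (hA : IsUnit A.det)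
    (hnd : (kkt K (fromRows Q τ)).det ≠ 0) :
    logZ (K + τᵀ * A * τ) Q =
      logZ K (fromRows Q τ) + (Fintype.card ρ : ℝ) / 2 * Real.log (2 * Real.pi) - (1 / 2 : ℝ) * Real.log |A.det| := by
  have h := det_kkt_add_weight K Q τ W A hKW hQW hT hA
  unfold logZ
  rw [h, abs_mul, abs_mul, abs_pow, abs_neg, abs_one, one_pow, one_mul,
    Real.log_mul (abs_ne_zero.mpr hA.ne_zero) (abs_ne_zero.mpr hnd), Fintype.card_sum, Nat.cast_add]
  ring

/-- SLICE CHANGE IN LOGARITHMIC FORM (the linearised Faddeev–Popov determinants): `K W = 0`, `Kᵀ W = 0`, `Q W = 0`,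
`τ W` and `P W` invertible, `det kkt K [Q; τ] ≠ 0` ⇒
`logZ K [Q; τ] = logZ K [Q; P] − log|det(τ W)| + log|det(P W)|`. [folklore] -/
theorem logZ_slice_change (K : Matrix ν ν ℝ) (Q : Matrix μ ν ℝ) (τ P : Matrix ρ ν ℝ) (W : Matrix ν ρ ℝ)
    (hKW : K * W = 0) (hKtW : Kᵀ * W = 0) (hQW : Q * W = 0) (hT : IsUnit (τ * W).det) (hS : IsUnit (P * W).det)
    (hnd : (kkt K (fromRows Q τ)).det ≠ 0) :
    logZ K (fromRows Q τ) = logZ K (fromRows Q P) - Real.log |(τ * W).det| + Real.log |(P * W).det| := by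
  have h := det_kkt_fromRows_slice_change K Q τ P W hKW hKtW hQW hT hS
  have hTne : (τ * W).det ≠ 0 := hT.ne_zero
  have hSne : (P * W).det ≠ 0 := hS.ne_zero
  have hndP : (kkt K (fromRows Q P)).det ≠ 0 := by
    intro h0
    rw [h0, zero_mul] at h
    exact (mul_ne_zero hnd (pow_ne_zero 2 hSne)) h.symm
  have hlog := congrArg (fun x : ℝ => Real.log |x|) h
  simp only [abs_mul, abs_pow] at hlog
  rw [Real.log_mul (abs_ne_zero.mpr hndP) (pow_ne_zero 2 (abs_ne_zero.mpr hTne)),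
    Real.log_mul (abs_ne_zero.mpr hnd) (pow_ne_zero 2 (abs_ne_zero.mpr hSne)), Real.log_pow, Real.log_pow] at hlog
  unfold logZ
  push_cast at hlog
  linarith

end RealLog

/-! ## §4. Over the cell's `Beta.OneLoop` objects: the `Fin`-indexed datum, background families, the polarization -/

section Reindex

variable {ν μ μ' : Type*} [Fintype ν] [Fintype μ] [Fintype μ'] [DecidableEq ν] [DecidableEq μ] [DecidableEq μ']

omit [Fintype ν] [Fintype μ] [Fintype μ'] [DecidableEq ν] [DecidableEq μ] [DecidableEq μ'] in
/-- Relabelling the constraints relabels the bordered matrix. [folklore] -/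
theorem kkt_reindex_constraint {𝕜 : Type*} [Field 𝕜] (H : Matrix ν ν 𝕜) (C : Matrix μ ν 𝕜) (e : μ ≃ μ') :
    kkt H (reindex e (Equiv.refl ν) C) =
      reindex (Equiv.sumCongr (Equiv.refl ν) e) (Equiv.sumCongr (Equiv.refl ν) e) (kkt H C) := by
  ext (i | j) (i' | j') <;> simp [kkt, Matrix.reindex_apply, Matrix.submatrix_apply]

/-- Relabelling the constraints does not change the closed-form `log Z`. [folklore] -/
theorem logZ_reindex_constraint (H : Matrix ν ν ℝ) (C : Matrix μ ν ℝ) (e : μ ≃ μ') :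
    logZ H (reindex e (Equiv.refl ν) C) = logZ H C := by
  unfold logZ
  rw [kkt_reindex_constraint, det_reindex_self, Fintype.card_congr e]

end Reindex

section OneLoopObjects

variable {n m r : ℕ}

/-- EXPONENTIAL (quadratic-weight) gauge fixing of a constrained Gaussian datum along slice rows `τ` (`r × n`): the weight
`exp(−½‖τv‖²)` is absorbed into the form, `Δ ↦ Δ + τᵀτ`, the constraints are unchanged — the shape of
[Balaban1987RG1] (1.5) p. 261 / (2.11) p. 267, where the gauge-fixing part of `⟨B, Δ^{(k)}B⟩` is `G^{(2)}(B)` with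
«G(B′) = Σ_{y∈T^{(k+1)}} Σ_{x∈B(y),x≠y} ½|B̃′(y,x)|² + G₃(B′) = ½G^{(2)}(B′) + G₃(B′)» ((2.5) p. 266), i.e.
`G^{(2)}(B) = ‖τB‖²` for `τ : B ↦ (B̃′(y,x))_{y, x≠y}`.  Pure data; which `τ` models (2.5) is a dictionary clause, not
asserted here.
[cite: Balaban1987RG1, (2.5) p.266] -/
def withWeight (Z : ConstrainedGaussian n m) (τ : Matrix (Fin r) (Fin n) ℝ) : ConstrainedGaussian n m :=
  ⟨Z.Q, Z.Δ + τᵀ * τ⟩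

/-- δ-FUNCTION gauge fixing along slice rows `τ` (`r × n`): the gauge conditions `τv = 0` are APPENDED TO THE CONSTRAINTS,
`Q ↦ [Q; τ]` (relabelled to `Fin (m + r)`), the form is unchanged — the shape of [Balaban1985BackgroundPropagators]
(3.155)–(3.156) pp. 427–428, «δ(Q₁B)δ_{Ax}(B)», «This form is considered on the subspace {B: B = 0 on Λᶜ, B = 0 on
∪_{y∈Λ′} Ax(y), Q₁B = 0}» (block axial gauge: `τ` = evaluation at the axial-gauge bonds `Ax(y)`).  Pure data.
[cite: Balaban1985BackgroundPropagators, (3.156) p.428] -/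
def withSlice (Z : ConstrainedGaussian n m) (τ : Matrix (Fin r) (Fin n) ℝ) : ConstrainedGaussian n (m + r) :=
  ⟨reindex finSumFinEquiv (Equiv.refl (Fin n)) (fromRows Z.Q τ), Z.Δ⟩

/-- Unfolding: the constraint of the weighted datum. [folklore] -/
@[simp] theorem withWeight_Q (Z : ConstrainedGaussian n m) (τ : Matrix (Fin r) (Fin n) ℝ) : (withWeight Z τ).Q = Z.Q :=
  rfl

/-- Unfolding: the form of the weighted datum. [folklore] -/
@[simp] theorem withWeight_Δ (Z : ConstrainedGaussian n m) (τ : Matrix (Fin r) (Fin n) ℝ) :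
    (withWeight Z τ).Δ = Z.Δ + τᵀ * τ :=
  rfl

/-- Unfolding: the constraint of the sliced datum. [folklore] -/
@[simp] theorem withSlice_Q (Z : ConstrainedGaussian n m) (τ : Matrix (Fin r) (Fin n) ℝ) :
    (withSlice Z τ).Q = reindex finSumFinEquiv (Equiv.refl (Fin n)) (fromRows Z.Q τ) :=
  rfl

/-- Unfolding: the form of the sliced datum. [folklore] -/
@[simp] theorem withSlice_Δ (Z : ConstrainedGaussian n m) (τ : Matrix (Fin r) (Fin n) ℝ) : (withSlice Z τ).Δ = Z.Δ :=
  rfl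

/-- `logZ` of the weighted datum in the sibling module's generic closed form. [folklore] -/
theorem logZ_withWeight_eq_comp (Z : ConstrainedGaussian n m) (τ : Matrix (Fin r) (Fin n) ℝ) :
    (withWeight Z τ).logZ = logZ (Z.Δ + τᵀ * τ) Z.Q :=
  ConstrainedGaussian.logZ_eq_comp _

/-- `det kkt` of the sliced datum = `det kkt Δ [Q; τ]` (relabelling). [folklore] -/
theorem det_kkt_withSlice (Z : ConstrainedGaussian n m) (τ : Matrix (Fin r) (Fin n) ℝ) :
    (withSlice Z τ).kkt.det = (kkt Z.Δ (fromRows Z.Q τ)).det := by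
  rw [ConstrainedGaussian.kkt_eq_comp]
  show (kkt Z.Δ (reindex finSumFinEquiv (Equiv.refl (Fin n)) (fromRows Z.Q τ))).det = _
  rw [kkt_reindex_constraint, det_reindex_self]

/-- `logZ` of the sliced datum in the generic closed form: `logZ Δ [Q; τ]`. [folklore] -/
theorem logZ_withSlice_eq_comp (Z : ConstrainedGaussian n m) (τ : Matrix (Fin r) (Fin n) ℝ) :
    (withSlice Z τ).logZ = logZ Z.Δ (fromRows Z.Q τ) := by
  rw [ConstrainedGaussian.logZ_eq_comp]
  exact logZ_reindex_constraint _ _ _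

/-- WEIGHT ≡ CONSTRAINT for the cell's datum: if some `n × r` matrix `W` of gauge directions has `Δ W = 0`, `Q W = 0` and
`τ W` invertible, then `logZ (withWeight Z τ) = logZ (withSlice Z τ) + (r/2)·log 2π` — exactly, with no side condition on
nondegeneracy (both sides are the same junk value in the degenerate case). [folklore] -/
theorem logZ_withWeight (Z : ConstrainedGaussian n m) (τ : Matrix (Fin r) (Fin n) ℝ) (W : Matrix (Fin n) (Fin r) ℝ)
    (hKW : Z.Δ * W = 0) (hQW : Z.Q * W = 0) (hT : IsUnit (τ * W).det) :
    (withWeight Z τ).logZ = (withSlice Z τ).logZ + (r : ℝ) / 2 * Real.log (2 * Real.pi) := by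
  rw [logZ_withWeight_eq_comp, logZ_withSlice_eq_comp, logZ_add_weight_one Z.Δ Z.Q τ W hKW hQW hT, Fintype.card_fin]

/-- SLICE CHANGE for the cell's datum (linearised Faddeev–Popov determinants): two-sided gauge directions (`Δ W = 0`,
`Δᵀ W = 0` — the same condition for symmetric `Δ`), `Q W = 0`, `τ W` and `P W` invertible, `det kkt (withSlice Z τ) ≠ 0` ⇒
`logZ (withSlice Z τ) = logZ (withSlice Z P) − log|det(τ W)| + log|det(P W)|`. [folklore] -/
theorem logZ_withSlice_change (Z : ConstrainedGaussian n m) (τ P : Matrix (Fin r) (Fin n) ℝ) (W : Matrix (Fin n) (Fin r) ℝ)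
    (hKW : Z.Δ * W = 0) (hKtW : Z.Δᵀ * W = 0) (hQW : Z.Q * W = 0) (hT : IsUnit (τ * W).det) (hS : IsUnit (P * W).det)
    (hnd : (withSlice Z τ).kkt.det ≠ 0) :
    (withSlice Z τ).logZ = (withSlice Z P).logZ - Real.log |(τ * W).det| + Real.log |(P * W).det| := by
  rw [det_kkt_withSlice] at hnd
  rw [logZ_withSlice_eq_comp, logZ_withSlice_eq_comp]
  exact logZ_slice_change Z.Δ Z.Q τ P W hKW hKtW hQW hT hS hnd

/-! ### Background families: the polarization does not see the gauge fixing -/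

/-- Adding a constant does not change an iterated Fréchet derivative of positive order. [folklore] -/
private theorem iteratedFDeriv_succ_add_const' {E : Type*} [NormedAddCommGroup E] [NormedSpace ℝ E]
    (f : E → ℝ) (c : ℝ) (k : ℕ) (x : E) :
    iteratedFDeriv ℝ (k + 1) (fun y => f y + c) x = iteratedFDeriv ℝ (k + 1) f x := by
  rw [iteratedFDeriv_succ_eq_comp_right, iteratedFDeriv_succ_eq_comp_right]
  simp only [Function.comp_apply, fderiv_add_const]

/-- Order two. [folklore] -/
private theorem iteratedFDeriv_two_add_const' {E : Type*} [NormedAddCommGroup E] [NormedSpace ℝ E]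
    (f : E → ℝ) (c : ℝ) (x : E) :
    iteratedFDeriv ℝ 2 (fun y => f y + c) x = iteratedFDeriv ℝ 2 f x :=
  iteratedFDeriv_succ_add_const' f c 1 x

variable {ι : Type*} [Fintype ι] [DecidableEq ι]

/-- The Hessian at `0` ignores additive constants (no differentiability hypothesis). [folklore] -/
theorem hessianAt_add_const (f : (ι → ℝ) → ℝ) (c : ℝ) : hessianAt (fun B => f B + c) = hessianAt f := by
  funext i j
  unfold hessianAt
  rw [iteratedFDeriv_two_add_const']

/-- The Hessian at `0` only sees the germ at `0`. [folklore] -/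
theorem hessianAt_congr_of_eventuallyEq {f g : (ι → ℝ) → ℝ} (h : f =ᶠ[nhds 0] g) : hessianAt f = hessianAt g := by
  funext i j
  unfold hessianAt
  rw [(h.iteratedFDeriv ℝ 2).eq_of_nhds]

/-- TWO BACKGROUND FAMILIES WHOSE `log Z` DIFFER, NEAR `B = 0`, BY A `B`-INDEPENDENT CONSTANT HAVE THE SAME POLARIZATION
(the model of (1.20) p. 264: `Π = δ²/δB² log Z` at `B = 0`).  The variable/constraint counts of the two families may differ.
[folklore] -/
theorem polarization_eq_of_logZ_eventuallyEq_add_const {n' m' : ℕ} (F : Family ι n m) (G : Family ι n' m') (c : ℝ)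
    (h : ∀ᶠ B in nhds 0, (F B).logZ = (G B).logZ + c) : polarization F = polarization G := by
  have hev : F.logZ =ᶠ[nhds 0] fun B => G.logZ B + c := h
  funext i j
  rw [polarization_eq_hessianAt, polarization_eq_hessianAt, hessianAt_congr_of_eventuallyEq hev, hessianAt_add_const]

/-- … hence the same torus kernel and the same finite-volume one-loop coefficient `β⁰_T`. [folklore] -/
theorem torusBetaZero_eq_of_polarization_eq {d s c n' m' : ℕ} [NeZero s] (F : Family (ExtIndex d s c) n m)
    (G : Family (ExtIndex d s c) n' m') (h : polarization F = polarization G) (a₀ : Fin c) (μ ν : Fin d) :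
    torusBetaZero F a₀ μ ν = torusBetaZero G a₀ μ ν := by
  unfold torusBetaZero torusKernel
  rw [h]

/-- ONE-LOOP GAUGE-FIXING INDEPENDENCE I (WEIGHT ≡ CONSTRAINT ON THE SAME SLICE).  For a background family `F`, slice rows
`τ B` and gauge directions `W B` with, for `B` near `0`: `Δ(B)·W(B) = 0`, `Q(B)·W(B) = 0`, `τ(B)·W(B)` invertible — the
exponentially gauge-fixed family `B ↦ withWeight (F B) (τ B)` and the δ-gauge-fixed family `B ↦ withSlice (F B) (τ B)` have
THE SAME polarization (their `log Z` differ by the constant `(r/2)·log 2π`).  No Faddeev–Popov factor and no nondegeneracy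
is needed for this step. [folklore] -/
theorem polarization_withWeight_eq_withSlice (F : Family ι n m) (τ : (ι → ℝ) → Matrix (Fin r) (Fin n) ℝ)
    (W : (ι → ℝ) → Matrix (Fin n) (Fin r) ℝ)
    (h : ∀ᶠ B in nhds 0, (F B).Δ * W B = 0 ∧ (F B).Q * W B = 0 ∧ IsUnit (τ B * W B).det) :
    polarization (fun B => withWeight (F B) (τ B)) = polarization (fun B => withSlice (F B) (τ B)) := by
  apply polarization_eq_of_logZ_eventuallyEq_add_const _ _ ((r : ℝ) / 2 * Real.log (2 * Real.pi))
  filter_upwards [h] with B hB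
  exact logZ_withWeight (F B) (τ B) (W B) hB.1 hB.2.1 hB.2.2

/-- ONE-LOOP GAUGE-FIXING INDEPENDENCE II (SLICE CHANGE, the linearised Faddeev–Popov step).  For `B` near `0` let `W B` be
two-sided gauge directions of `Δ(B)` (`Δ W = 0`, `Δᵀ W = 0`) with `Q(B)·W(B) = 0`, let both slices be admissible (`τ W`, `P W`
invertible) and the sliced bordered matrix nondegenerate, and let the FADDEEV–POPOV QUOTIENT `log|det(P W)| − log|det(τ W)|`
be CONSTANT in `B` near `0` (it does not depend on the choice of basis `W` of the directions).  Then the two δ-gauge-fixed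
families have the same polarization. [folklore] -/
theorem polarization_withSlice_eq_withSlice (F : Family ι n m) (τ P : (ι → ℝ) → Matrix (Fin r) (Fin n) ℝ)
    (W : (ι → ℝ) → Matrix (Fin n) (Fin r) ℝ) (c : ℝ)
    (h : ∀ᶠ B in nhds 0, (F B).Δ * W B = 0 ∧ (F B).Δᵀ * W B = 0 ∧ (F B).Q * W B = 0 ∧ IsUnit (τ B * W B).det ∧
      IsUnit (P B * W B).det ∧ (withSlice (F B) (τ B)).kkt.det ≠ 0)
    (hFP : ∀ᶠ B in nhds 0, Real.log |(P B * W B).det| - Real.log |(τ B * W B).det| = c) :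
    polarization (fun B => withSlice (F B) (τ B)) = polarization (fun B => withSlice (F B) (P B)) := by
  apply polarization_eq_of_logZ_eventuallyEq_add_const _ _ c
  filter_upwards [h, hFP] with B hB hc
  rw [logZ_withSlice_change (F B) (τ B) (P B) (W B) hB.1 hB.2.1 hB.2.2.1 hB.2.2.2.1 hB.2.2.2.2.1 hB.2.2.2.2.2, ← hc]
  ring

/-- I + II: EXPONENTIAL GAUGE FIXING ON THE SLICE `τ` versus δ-FUNCTION (block axial) GAUGE FIXING ON THE SLICE `P` give the
same polarization, under the hypotheses of I and II together — the one-loop shadow of [Balaban1987RG1] p. 255 «we apply the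
usual Faddeev-Popov procedure … By the gauge invariance with respect to such transformations the integrand does not depend on
u and the integral over u is equal to 1» and p. 267 «see the definition (3.156) [13] with the δ-function gauge fixing term
replaced by the exponential one».  The group-level (all-orders) statement is NOT formalised here.
[cite: Balaban1987RG1, (0.16) p.255] -/
theorem polarization_withWeight_eq_withSlice' (F : Family ι n m) (τ P : (ι → ℝ) → Matrix (Fin r) (Fin n) ℝ)
    (W : (ι → ℝ) → Matrix (Fin n) (Fin r) ℝ) (c : ℝ)
    (h : ∀ᶠ B in nhds 0, (F B).Δ * W B = 0 ∧ (F B).Δᵀ * W B = 0 ∧ (F B).Q * W B = 0 ∧ IsUnit (τ B * W B).det ∧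
      IsUnit (P B * W B).det ∧ (withSlice (F B) (τ B)).kkt.det ≠ 0)
    (hFP : ∀ᶠ B in nhds 0, Real.log |(P B * W B).det| - Real.log |(τ B * W B).det| = c) :
    polarization (fun B => withWeight (F B) (τ B)) = polarization (fun B => withSlice (F B) (P B)) := by
  rw [polarization_withWeight_eq_withSlice F τ W (by filter_upwards [h] with B hB; exact ⟨hB.1, hB.2.2.1, hB.2.2.2.1⟩)]
  exact polarization_withSlice_eq_withSlice F τ P W c h hFP

/-- The same for the finite-volume one-loop coefficient of a torus family: `β⁰_T` in the exponential gauge on `τ` =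
`β⁰_T` in the δ-gauge on `P`, under the hypotheses of I + II. [folklore] -/
theorem torusBetaZero_withWeight_eq_withSlice {d s c : ℕ} [NeZero s] (F : Family (ExtIndex d s c) n m)
    (τ P : (ExtIndex d s c → ℝ) → Matrix (Fin r) (Fin n) ℝ) (W : (ExtIndex d s c → ℝ) → Matrix (Fin n) (Fin r) ℝ)
    (c₀ : ℝ)
    (h : ∀ᶠ B in nhds 0, (F B).Δ * W B = 0 ∧ (F B).Δᵀ * W B = 0 ∧ (F B).Q * W B = 0 ∧ IsUnit (τ B * W B).det ∧
      IsUnit (P B * W B).det ∧ (withSlice (F B) (τ B)).kkt.det ≠ 0)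
    (hFP : ∀ᶠ B in nhds 0, Real.log |(P B * W B).det| - Real.log |(τ B * W B).det| = c₀) (a₀ : Fin c) (μ ν : Fin d) :
    torusBetaZero (fun B => withWeight (F B) (τ B)) a₀ μ ν = torusBetaZero (fun B => withSlice (F B) (P B)) a₀ μ ν :=
  torusBetaZero_eq_of_polarization_eq _ _ (polarization_withWeight_eq_withSlice' F τ P W c₀ h hFP) a₀ μ ν

end OneLoopObjects

/-! ## §5. (v1.1) THE SLICE-CHANGE DEFECT — theorem II when the Faddeev–Popov quotient (c3) is NOT constant

v1's headline II (`polarization_withSlice_eq_withSlice`) compares two δ-gauge-fixed families under the dictionary clause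
(c3) «`log|det(P(B)W(B))| − log|det(τ(B)W(B))|` constant in `B` near `0`», and the v1 header READS OFF the failure case
(«If (c3) fails the two polarizations differ by the Hessian at `0` of that quotient»).  This section TYPES that reading:
the pointwise identity `logZ_withSlice_change` is differentiated twice at `B = 0`.  Unlike the constant case
(`polarization_eq_of_logZ_eventuallyEq_add_const`, no regularity needed: the Hessian kills constants), splitting the
Hessian of a SUM needs `C²` germs at `0` (`iteratedFDeriv_add_apply`; outside `C²` both sides are junk values), so the
defect theorems carry `ContDiffAt ℝ 2 · 0` hypotheses on ONE `log Z` and on the two Faddeev–Popov logarithms.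
* `hessianAt_add` / `hessianAt_sub` / `hessianAt_neg` — the calculus of `hessianAt` (v1 had only `hessianAt_add_const`).
* `log_abs_det_slice_mul_basis`, `fpQuotient_basis_change` — the quotient is BASIS-FREE: replacing the directions `W` by
  `W·G` (`G` invertible, `B`-dependent allowed) shifts both logarithms by `log|det G|`, so (c3) and the defect depend only
  on the two slices and the SPAN of the directions (the linearised orbit directions at `B`), not on their parametrisation.
* `polarization_withSlice_eq_sub_add` (II′, THE DEFECT FORM): under (c1) (c2), admissibility and nondegeneracy near `0`
  and the three `C²` hypotheses,
  `polarization (withSlice F τ) i j = polarization (withSlice F P) i j − hessianAt log|det(τW)| i j + hessianAt log|det(PW)| i j`.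
  With `P := τ′` a second slice this IS the two-slice formula «`Hess log Z_τ − Hess log Z_τ′ = Hess log|det(τ′W)| −
  Hess log|det(τW)|`».
* `polarization_withSlice_eq_sub_of_log_eventuallyEq_const` (II″, HALF-CONSTANT): if only `log|det(P(B)W(B))|` is
  constant near `0` (e.g. a UNIPOTENT slice, `|det(P(B)W(B))| = 1`: `polarization_withSlice_eq_add_of_abs_det_eq_one`),
  then `polarization (withSlice F P) = polarization (withSlice F τ) + hessianAt log|det(τW)|` entrywise — the second
  δ-family's polarization is the first one's PLUS the Hessian at `0` of the first slice's Faddeev–Popov logarithm.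
* `polarization_withWeight_eq_sub_add` — the same with the exponential weight on `τ` (I + II′).
TRIGGER (a journal event of the audit cell, NOT a source): β-sub-cell lead finding F-lead-g12-1 (pub-balaban CLAIMS.log,
2026-08-19) asked the author lineage to check (c3) and the slice-change identity; the finding's APPLICATION (which typed
slice of which row is or is not unipotent along which directions, and what the defect then is) is NOT made here.  As in
v1: every statement is [folklore] finite-dimensional algebra / calculus over Mathlib and the sibling modules by name; no
`def … : Prop`, no fact of the audited series is used or discharged; NOT summit progress. -/

section SliceDefect

/-! ### §5a. Calculus of `hessianAt` -/

section HessianCalculus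

variable {ι : Type*} [Fintype ι] [DecidableEq ι]

/-- The Hessian at `0` of a sum of two `C²` germs is the sum of the Hessians. [folklore] -/
theorem hessianAt_add {f g : (ι → ℝ) → ℝ} (hf : ContDiffAt ℝ 2 f 0) (hg : ContDiffAt ℝ 2 g 0) (i j : ι) :
    hessianAt (fun B => f B + g B) i j = hessianAt f i j + hessianAt g i j := by
  unfold hessianAt
  rw [show (fun B => f B + g B) = f + g from rfl, iteratedFDeriv_add_apply hf hg]
  rfl

/-- The Hessian at `0` of the negative (no regularity needed). [folklore] -/
theorem hessianAt_neg (f : (ι → ℝ) → ℝ) (i j : ι) : hessianAt (fun B => -f B) i j = -hessianAt f i j := by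
  unfold hessianAt
  rw [show (fun B => -f B) = -f from rfl, iteratedFDeriv_neg_apply]
  rfl

/-- The Hessian at `0` of a difference of two `C²` germs. [folklore] -/
theorem hessianAt_sub {f g : (ι → ℝ) → ℝ} (hf : ContDiffAt ℝ 2 f 0) (hg : ContDiffAt ℝ 2 g 0) (i j : ι) :
    hessianAt (fun B => f B - g B) i j = hessianAt f i j - hessianAt g i j := by
  unfold hessianAt
  rw [show (fun B => f B - g B) = f - g from rfl, iteratedFDeriv_sub_apply hf hg]
  rfl

/-- Entrywise form of v1's `hessianAt_add_const`. [folklore] -/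
theorem hessianAt_add_const_apply (f : (ι → ℝ) → ℝ) (c : ℝ) (i j : ι) :
    hessianAt (fun B => f B + c) i j = hessianAt f i j := by
  rw [hessianAt_add_const]

/-- Entrywise congruence along a germ at `0`. [folklore] -/
theorem hessianAt_congr_apply {f g : (ι → ℝ) → ℝ} (h : f =ᶠ[nhds 0] g) (i j : ι) :
    hessianAt f i j = hessianAt g i j := by
  rw [hessianAt_congr_of_eventuallyEq h]

end HessianCalculus

/-! ### §5b. The Faddeev–Popov quotient is basis-free -/

section BasisFree

variable {n r : ℕ}

/-- Changing the basis of the directions, `W ↦ W·G`, multiplies a slice determinant by `det G`. [folklore] -/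
theorem det_slice_mul_basis (τ : Matrix (Fin r) (Fin n) ℝ) (W : Matrix (Fin n) (Fin r) ℝ)
    (G : Matrix (Fin r) (Fin r) ℝ) : (τ * (W * G)).det = (τ * W).det * G.det := by
  rw [← Matrix.mul_assoc, Matrix.det_mul]

/-- … hence shifts its Faddeev–Popov logarithm by `log|det G|` (nondegenerate case). [folklore] -/
theorem log_abs_det_slice_mul_basis (τ : Matrix (Fin r) (Fin n) ℝ) (W : Matrix (Fin n) (Fin r) ℝ)
    (G : Matrix (Fin r) (Fin r) ℝ) (hτ : (τ * W).det ≠ 0) (hG : G.det ≠ 0) :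
    Real.log |(τ * (W * G)).det| = Real.log |(τ * W).det| + Real.log |G.det| := by
  rw [det_slice_mul_basis, abs_mul, Real.log_mul (abs_ne_zero.mpr hτ) (abs_ne_zero.mpr hG)]

/-- THE QUOTIENT IS BASIS-FREE: for two slices `τ`, `P` and a change of basis `G` of the directions (all nondegenerate),
`log|det(P(WG))| − log|det(τ(WG))| = log|det(PW)| − log|det(τW)|`.  So clause (c3) and the defect of §5c depend on the
slices and the span of `W` only. [folklore] -/
theorem fpQuotient_basis_change (τ P : Matrix (Fin r) (Fin n) ℝ) (W : Matrix (Fin n) (Fin r) ℝ)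
    (G : Matrix (Fin r) (Fin r) ℝ) (hτ : (τ * W).det ≠ 0) (hP : (P * W).det ≠ 0) (hG : G.det ≠ 0) :
    Real.log |(P * (W * G)).det| - Real.log |(τ * (W * G)).det| =
      Real.log |(P * W).det| - Real.log |(τ * W).det| := by
  rw [log_abs_det_slice_mul_basis τ W G hτ hG, log_abs_det_slice_mul_basis P W G hP hG]
  ring

/-- Pointwise-in-`B` form: a `B`-dependent change of basis does not change the quotient FUNCTION near `0`, hence neither
(c3) nor any Hessian of it. [folklore] -/
theorem fpQuotient_basis_change_eventually {ι : Type*} [TopologicalSpace ι]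
    (τ P : ι → Matrix (Fin r) (Fin n) ℝ) (W : ι → Matrix (Fin n) (Fin r) ℝ) (G : ι → Matrix (Fin r) (Fin r) ℝ) {l : Filter ι}
    (h : ∀ᶠ B in l, (τ B * W B).det ≠ 0 ∧ (P B * W B).det ≠ 0 ∧ (G B).det ≠ 0) :
    (fun B => Real.log |(P B * (W B * G B)).det| - Real.log |(τ B * (W B * G B)).det|) =ᶠ[l]
      fun B => Real.log |(P B * W B).det| - Real.log |(τ B * W B).det| := by
  filter_upwards [h] with B hB
  exact fpQuotient_basis_change (τ B) (P B) (W B) (G B) hB.1 hB.2.1 hB.2.2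

end BasisFree

/-! ### §5c. Theorem II with defect -/

section Defect

variable {n m r : ℕ}
variable {ι : Type*} [Fintype ι] [DecidableEq ι]

/-- ONE-LOOP SLICE CHANGE WITH DEFECT (II′).  For `B` near `0` let `W B` be two-sided gauge directions of `Δ(B)`
(`Δ W = 0`, `Δᵀ W = 0`) with `Q(B)·W(B) = 0`, both slices admissible (`τ W`, `P W` invertible) and the `τ`-sliced bordered
matrix nondegenerate; assume the `P`-family's `log Z` and the two Faddeev–Popov logarithms are `C²` at `0`.  Then
`Π_τ = Π_P − Hess₀ log|det(τW)| + Hess₀ log|det(PW)|` entrywise: the two δ-gauge-fixed polarizations differ by the Hessian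
at `0` of the Faddeev–Popov quotient.  (c3) is the case in which the two Hessians cancel (then no `C²` hypothesis is
needed: v1's `polarization_withSlice_eq_withSlice`).  With `P := τ′` a second slice this is the two-slice formula.
[folklore] -/
theorem polarization_withSlice_eq_sub_add (F : Family ι n m) (τ P : (ι → ℝ) → Matrix (Fin r) (Fin n) ℝ)
    (W : (ι → ℝ) → Matrix (Fin n) (Fin r) ℝ)
    (h : ∀ᶠ B in nhds 0, (F B).Δ * W B = 0 ∧ (F B).Δᵀ * W B = 0 ∧ (F B).Q * W B = 0 ∧ IsUnit (τ B * W B).det ∧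
      IsUnit (P B * W B).det ∧ (withSlice (F B) (τ B)).kkt.det ≠ 0)
    (hP : ContDiffAt ℝ 2 (Family.logZ fun B => withSlice (F B) (P B)) 0)
    (hτW : ContDiffAt ℝ 2 (fun B => Real.log |(τ B * W B).det|) 0)
    (hPW : ContDiffAt ℝ 2 (fun B => Real.log |(P B * W B).det|) 0) (i j : ι) :
    polarization (fun B => withSlice (F B) (τ B)) i j =
      polarization (fun B => withSlice (F B) (P B)) i j
        - hessianAt (fun B => Real.log |(τ B * W B).det|) i j
        + hessianAt (fun B => Real.log |(P B * W B).det|) i j := by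
  have hev : (Family.logZ fun B => withSlice (F B) (τ B)) =ᶠ[nhds 0]
      fun B => ((Family.logZ fun B => withSlice (F B) (P B)) B - Real.log |(τ B * W B).det|)
        + Real.log |(P B * W B).det| := by
    filter_upwards [h] with B hB
    exact logZ_withSlice_change (F B) (τ B) (P B) (W B) hB.1 hB.2.1 hB.2.2.1 hB.2.2.2.1 hB.2.2.2.2.1 hB.2.2.2.2.2
  rw [polarization_eq_hessianAt, polarization_eq_hessianAt, hessianAt_congr_apply hev,
    hessianAt_add (hP.sub hτW) hPW, hessianAt_sub hP hτW]

/-- II″ (HALF-CONSTANT QUOTIENT): if the SECOND slice's Faddeev–Popov logarithm `log|det(P(B)W(B))|` is constant near `0`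
(no regularity asked of it), then `Π_τ = Π_P − Hess₀ log|det(τW)|` entrywise. [folklore] -/
theorem polarization_withSlice_eq_sub_of_log_eventuallyEq_const (F : Family ι n m)
    (τ P : (ι → ℝ) → Matrix (Fin r) (Fin n) ℝ) (W : (ι → ℝ) → Matrix (Fin n) (Fin r) ℝ) (c : ℝ)
    (h : ∀ᶠ B in nhds 0, (F B).Δ * W B = 0 ∧ (F B).Δᵀ * W B = 0 ∧ (F B).Q * W B = 0 ∧ IsUnit (τ B * W B).det ∧
      IsUnit (P B * W B).det ∧ (withSlice (F B) (τ B)).kkt.det ≠ 0)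
    (hc : ∀ᶠ B in nhds 0, Real.log |(P B * W B).det| = c)
    (hP : ContDiffAt ℝ 2 (Family.logZ fun B => withSlice (F B) (P B)) 0)
    (hτW : ContDiffAt ℝ 2 (fun B => Real.log |(τ B * W B).det|) 0) (i j : ι) :
    polarization (fun B => withSlice (F B) (τ B)) i j =
      polarization (fun B => withSlice (F B) (P B)) i j - hessianAt (fun B => Real.log |(τ B * W B).det|) i j := by
  have hev : (Family.logZ fun B => withSlice (F B) (τ B)) =ᶠ[nhds 0]
      fun B => ((Family.logZ fun B => withSlice (F B) (P B)) B - Real.log |(τ B * W B).det|) + c := by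
    filter_upwards [h, hc] with B hB hcB
    rw [← hcB]
    exact logZ_withSlice_change (F B) (τ B) (P B) (W B) hB.1 hB.2.1 hB.2.2.1 hB.2.2.2.1 hB.2.2.2.2.1 hB.2.2.2.2.2
  rw [polarization_eq_hessianAt, polarization_eq_hessianAt, hessianAt_congr_apply hev, hessianAt_add_const_apply,
    hessianAt_sub hP hτW]

/-- II″ for a UNIPOTENT second slice (`|det(P(B)W(B))| = 1` near `0`, e.g. a slice that is block-triangular along the
directions with unimodular diagonal blocks): `Π_P = Π_τ + Hess₀ log|det(τW)|` entrywise — the polarization of the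
`P`-family is that of the `τ`-family PLUS the Hessian at `0` of `τ`'s Faddeev–Popov logarithm along the directions `W`.
[folklore] -/
theorem polarization_withSlice_eq_add_of_abs_det_eq_one (F : Family ι n m)
    (τ P : (ι → ℝ) → Matrix (Fin r) (Fin n) ℝ) (W : (ι → ℝ) → Matrix (Fin n) (Fin r) ℝ)
    (h : ∀ᶠ B in nhds 0, (F B).Δ * W B = 0 ∧ (F B).Δᵀ * W B = 0 ∧ (F B).Q * W B = 0 ∧ IsUnit (τ B * W B).det ∧
      IsUnit (P B * W B).det ∧ (withSlice (F B) (τ B)).kkt.det ≠ 0)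
    (h1 : ∀ᶠ B in nhds 0, |(P B * W B).det| = 1)
    (hP : ContDiffAt ℝ 2 (Family.logZ fun B => withSlice (F B) (P B)) 0)
    (hτW : ContDiffAt ℝ 2 (fun B => Real.log |(τ B * W B).det|) 0) (i j : ι) :
    polarization (fun B => withSlice (F B) (P B)) i j =
      polarization (fun B => withSlice (F B) (τ B)) i j + hessianAt (fun B => Real.log |(τ B * W B).det|) i j := by
  have hc : ∀ᶠ B in nhds 0, Real.log |(P B * W B).det| = 0 := by
    filter_upwards [h1] with B hB
    rw [hB, Real.log_one]
  rw [polarization_withSlice_eq_sub_of_log_eventuallyEq_const F τ P W 0 h hc hP hτW i j]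
  ring

/-- I + II′: the EXPONENTIAL weight on `τ` versus the δ-gauge on `P`, with defect (v1's I is unconditional and exact, so
only II′'s hypotheses appear). [folklore] -/
theorem polarization_withWeight_eq_sub_add (F : Family ι n m) (τ P : (ι → ℝ) → Matrix (Fin r) (Fin n) ℝ)
    (W : (ι → ℝ) → Matrix (Fin n) (Fin r) ℝ)
    (h : ∀ᶠ B in nhds 0, (F B).Δ * W B = 0 ∧ (F B).Δᵀ * W B = 0 ∧ (F B).Q * W B = 0 ∧ IsUnit (τ B * W B).det ∧
      IsUnit (P B * W B).det ∧ (withSlice (F B) (τ B)).kkt.det ≠ 0)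
    (hP : ContDiffAt ℝ 2 (Family.logZ fun B => withSlice (F B) (P B)) 0)
    (hτW : ContDiffAt ℝ 2 (fun B => Real.log |(τ B * W B).det|) 0)
    (hPW : ContDiffAt ℝ 2 (fun B => Real.log |(P B * W B).det|) 0) (i j : ι) :
    polarization (fun B => withWeight (F B) (τ B)) i j =
      polarization (fun B => withSlice (F B) (P B)) i j
        - hessianAt (fun B => Real.log |(τ B * W B).det|) i j
        + hessianAt (fun B => Real.log |(P B * W B).det|) i j := by
  rw [polarization_withWeight_eq_withSlice F τ W (by filter_upwards [h] with B hB; exact ⟨hB.1, hB.2.2.1, hB.2.2.2.1⟩)]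
  exact polarization_withSlice_eq_sub_add F τ P W h hP hτW hPW i j

/-- The torus one-loop coefficient inherits the defect entrywise through `torusKernel` only via `polarization`; recorded
as the implication «equal polarizations ⇒ equal `β⁰_T`» already in v1 (`torusBetaZero_eq_of_polarization_eq`).  Here:
if the defect Hessians CANCEL entrywise (the (c3) situation reached through II′), the `β⁰_T` agree. [folklore] -/
theorem torusBetaZero_withSlice_eq_of_defect_cancels {d s c : ℕ} [NeZero s] (F : Family (ExtIndex d s c) n m)
    (τ P : (ExtIndex d s c → ℝ) → Matrix (Fin r) (Fin n) ℝ) (W : (ExtIndex d s c → ℝ) → Matrix (Fin n) (Fin r) ℝ)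
    (h : ∀ᶠ B in nhds 0, (F B).Δ * W B = 0 ∧ (F B).Δᵀ * W B = 0 ∧ (F B).Q * W B = 0 ∧ IsUnit (τ B * W B).det ∧
      IsUnit (P B * W B).det ∧ (withSlice (F B) (τ B)).kkt.det ≠ 0)
    (hP : ContDiffAt ℝ 2 (Family.logZ fun B => withSlice (F B) (P B)) 0)
    (hτW : ContDiffAt ℝ 2 (fun B => Real.log |(τ B * W B).det|) 0)
    (hPW : ContDiffAt ℝ 2 (fun B => Real.log |(P B * W B).det|) 0)
    (hcancel : hessianAt (fun B => Real.log |(τ B * W B).det|) = hessianAt (fun B => Real.log |(P B * W B).det|))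
    (a₀ : Fin c) (μ ν : Fin d) :
    torusBetaZero (fun B => withSlice (F B) (τ B)) a₀ μ ν = torusBetaZero (fun B => withSlice (F B) (P B)) a₀ μ ν := by
  apply torusBetaZero_eq_of_polarization_eq
  funext i j
  rw [polarization_withSlice_eq_sub_add F τ P W h hP hτW hPW i j, hcancel]
  ring

end Defect

end SliceDefect

end Literature.MathematicalPhysics.QuantumFieldTheory.Balaban1983to89.Beta.GaugeFixing
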